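import Mathlib
import HarnessLib
import Summits.ValiantsHypothesis.ValiantsHypothesis.Theorems.LacunarySymmetroidMatrixDescartesProductPlusOneSeparatingWeight

/-!
# ValiantsHypothesis / LacunarySymmetroid — crux `MatrixDescartes` (stmt-ValiantsHypothesis-18050, V1),
# LINE (A) «product_plus_one», floor `OneChangeFloorK3`: the PULL of an unswitched incoherent row is LOG-CONVEX (algebraic core),
# and log-convexity AGGREGATES over the unswitched block

Towards the budget for the non-separable zeros left open by ✓ `…SeparatingWeight*` (the floor's residual: zeros of `Φ = Σ_r θg_r/g_r`
in a gap `(ρ_k, ρ_{k+1})` at which no weight separates the switched rows from the unswitched ones).  Write, for an incoherent no-dip row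
`g = a − βx^p − γx^q` (`a, β, γ > 0`) BEFORE its zero (`g > 0`): pull `Π = |θg/g| = N/g` with `N = −θg = pβx^p + qγx^q > 0`,
`M₁ = θN = p²βx^p + q²γx^q`, `M₂ = θ²N = p³βx^p + q³γx^q`.  Then `θΠ = (g·M₁ + N²)/g²`, `θ²Π = (g²M₂ + 3gN·M₁ + 2N³)/g³` and

  `Π·θ²Π − (θΠ)² = (g²·(N·M₂ − M₁²) + g·N²·M₁ + N⁴)/g⁴`,   `N·M₂ − M₁² = pq(q−p)²·βγ·x^p x^q ≥ 0`,

so `Π` is LOG-CONVEX in `u = log x` on `(0, ρ)` (`sepWeight_pull_logconvex_numerator_eq`, `_pos`).  Log-convexity aggregates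
(`sepWeight_logconvex_sum`: `s_i > 0`, `r_i² ≤ s_i t_i` ⇒ `(Σ r_i)² ≤ (Σ s_i)(Σ t_i)`, Cauchy–Schwarz), hence the TOTAL PULL
`S_U = Σ_{unswitched} Π_i` of a gap is log-convex in `u`, i.e. its logarithmic rate `⟨τ⟩_U = θ log S_U` — the pull-weighted average of the
row rates `τ_i = θ log Π_i` that the separating weight must stay below (✓ `sepWeight_wronskian_neg`: at a zero, `x·Φ′ ∝ ⟨τ⟩_R − ⟨τ⟩_U`) — is
NON-DECREASING along the gap.  Consequence for the open budget (paper, recorded in the item's NOTE): every return of `Φ` from below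
(an up-crossing) must be produced by the SWITCHED rows' average rate `⟨τ⟩_R = θ log S_R` overtaking a non-decreasing function; the
pullers never help twice.

* `sepWeight_pull_theta_identities` — the closed forms of `N·M₂ − M₁²` (pure algebra in `X = x^p`, `Y = x^q`);
* `sepWeight_pull_logconvex_numerator_eq` / `sepWeight_pull_logconvex_numerator_pos` — the displayed identity and its positivity for `g > 0`;
* `sepWeight_logconvex_sum` — aggregation of the pointwise log-convexity inequality over a finite block.

HONEST FRAMING: algebraic core of one step of the research floor's missing budget (the calculus wiring `θΠ`, `θ²Π` as derivatives of the
real function is routine and not typed here); closes nothing; NOT `OneChangeFloorK3` / the stubs / `MatrixDescartes`; `VP ≠ VNP` is NOT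
proved.  No definitions, no named facts, no sorry.
-/

set_option linter.dupNamespace false

namespace Summit.ValiantsHypothesis.ValiantsHypothesis.Theorems.LacunarySymmetroidMatrixDescartes

namespace ProductPlusOne

open Finset
open scoped BigOperators

/-- **`N·θ²N − (θN)² = pq(q−p)²·βγ·XY`** for `N = pβX + qγY`, `θN = p²βX + q²γY`, `θ²N = p³βX + q³γY` (`X = x^p`, `Y = x^q`). [folklore] -/
theorem sepWeight_pull_theta_identities (p q β γ X Y : ℝ) :
    (p * β * X + q * γ * Y) * (p ^ 3 * β * X + q ^ 3 * γ * Y) - (p ^ 2 * β * X + q ^ 2 * γ * Y) ^ 2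
      = p * q * (q - p) ^ 2 * (β * γ) * (X * Y) := by
  ring

/-- **Log-convexity numerator of the pull** (pure algebra; `g, N, M₁, M₂` arbitrary reals):
`N·(g²M₂ + 3gN·M₁ + 2N³) − (g·M₁ + N²)² = g²·(N·M₂ − M₁²) + g·N²·M₁ + N⁴`. [this file's lemma] -/
theorem sepWeight_pull_logconvex_numerator_eq (g N M₁ M₂ : ℝ) :
    N * (g ^ 2 * M₂ + 3 * g * N * M₁ + 2 * N ^ 3) - (g * M₁ + N ^ 2) ^ 2
      = g ^ 2 * (N * M₂ - M₁ ^ 2) + g * N ^ 2 * M₁ + N ^ 4 := by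
  ring

/-- **The pull of an unswitched incoherent row is log-convex (pointwise algebraic form)**: with `N = pβX + qγY`, `M₁ = p²βX + q²γY`,
`M₂ = p³βX + q³γY`, `0 < p < q`, `β, γ ≥ 0` not both zero... here `β, γ, X, Y > 0`, and `g > 0` (before the row's zero),
`(g·M₁ + N²)² < N·(g²M₂ + 3gN·M₁ + 2N³)` — i.e. `(θΠ)² < Π·θ²Π` after division by `g⁴`. [this file's theorem] -/
theorem sepWeight_pull_logconvex_numerator_pos {p q β γ X Y g : ℝ} (hp : 0 < p) (hpq : p < q) (hβ : 0 < β) (hγ : 0 < γ)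
    (hX : 0 < X) (hY : 0 < Y) (hg : 0 < g) :
    (g * (p ^ 2 * β * X + q ^ 2 * γ * Y) + (p * β * X + q * γ * Y) ^ 2) ^ 2
      < (p * β * X + q * γ * Y) * (g ^ 2 * (p ^ 3 * β * X + q ^ 3 * γ * Y)
          + 3 * g * (p * β * X + q * γ * Y) * (p ^ 2 * β * X + q ^ 2 * γ * Y) + 2 * (p * β * X + q * γ * Y) ^ 3) := by
  have hq : 0 < q := hp.trans hpq
  have key := sepWeight_pull_logconvex_numerator_eq g (p * β * X + q * γ * Y) (p ^ 2 * β * X + q ^ 2 * γ * Y)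
    (p ^ 3 * β * X + q ^ 3 * γ * Y)
  rw [sepWeight_pull_theta_identities] at key
  have hN : 0 < p * β * X + q * γ * Y := by positivity
  have hM : 0 < p ^ 2 * β * X + q ^ 2 * γ * Y := by positivity
  have h1 : 0 ≤ g ^ 2 * (p * q * (q - p) ^ 2 * (β * γ) * (X * Y)) := by positivity
  have h2 : 0 < g * (p * β * X + q * γ * Y) ^ 2 * (p ^ 2 * β * X + q ^ 2 * γ * Y) := by positivity
  have h3 : 0 < (p * β * X + q * γ * Y) ^ 4 := by positivity
  linarith

/-- **Log-convexity aggregates over a block** (Cauchy–Schwarz): if `s_i > 0` and `r_i² ≤ s_i·t_i` for every `i ∈ S`, then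
`(Σ_S r_i)² ≤ (Σ_S s_i)·(Σ_S t_i)` — so a sum of log-convex positive functions is log-convex (`r = θs`, `t = θ²s`). [folklore] -/
theorem sepWeight_logconvex_sum {ι : Type*} (S : Finset ι) (s t r : ι → ℝ) (hs : ∀ i ∈ S, 0 < s i)
    (hrt : ∀ i ∈ S, r i ^ 2 ≤ s i * t i) :
    (∑ i ∈ S, r i) ^ 2 ≤ (∑ i ∈ S, s i) * ∑ i ∈ S, t i := by
  refine Finset.sum_sq_le_sum_mul_sum_of_sq_le_mul S (fun i hi => (hs i hi).le) (fun i hi => ?_) hrt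
  -- `t_i ≥ 0` since `s_i t_i ≥ r_i² ≥ 0` and `s_i > 0`
  have h := hrt i hi
  have h0 : 0 ≤ s i * t i := (sq_nonneg _).trans h
  exact (mul_nonneg_iff_of_pos_left (hs i hi)).mp h0

end ProductPlusOne

end Summit.ValiantsHypothesis.ValiantsHypothesis.Theorems.LacunarySymmetroidMatrixDescartes
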